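import Summits.KontsevichZagierPeriods.KontsevichZagierPeriods.Theorems.ValuedFieldSpecialisationParametricLiftingStrata

/-!
# Route ValuedFieldSpecialisation — crux `ParametricLifting` (stmt-KontsevichZagierPeriods-3498):
# graded special-fibre rigidity from the kernel conjecture on a level (lead c9, sub-goal W1)

Helper (`--supports stmt-KontsevichZagierPeriods-3498`) for line `registered`. Write level `E` :=
`AddSubgroup.closure {[r] | dim r < E}` and KL(`E`) := "every `x` on level `E` with `KZ.eval x = 0` is a
relation". Special-fibre rigidity SF says: if `Rᵢ → r₀ᵢ` are dominated families and `Σ mᵢ [Rᵢ]` is a fibred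
relation, then the special-fibre class `Σ mᵢ [r₀ᵢ]` is a relation. Its GRADED form SFG(`E`) restricts to
fibres `r₀ᵢ` of dimension `d i < E`.

This file: `stub_specialFibreGraded_of_kernelLevel` — **KL(`E`) ⇒ SFG(`E`)**. The value shadow of SF is the
tree theorem `eval_specialFibre_eq_zero` (`…ParametricLiftingStrength.lean`): `KZ.eval (Σ mᵢ [r₀ᵢ]) = 0`;
the class `Σ mᵢ [r₀ᵢ]` lies on level `E` because every `r₀ᵢ` has dimension `d i < E`
(`AddSubgroup.sum_mem`, `AddSubgroup.zsmul_mem`, `AddSubgroup.subset_closure`); KL(`E`) concludes.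

Sources: M. Kontsevich, D. Zagier, *Periods* (2001), §1.2, Conjecture 1. The fibred / dominated vocabulary is
this route's (`KZFibredRelations.lean`, `KZDominatedFamily.lean`). No definitions.
-/

noncomputable section

namespace Summit.KontsevichZagierPeriods.ValuedFieldSpecialisation

open MeasureTheory Set Filter
open scoped Topology
open Literature.NumberTheory.Transcendental

/-- **KL(`E`) ⇒ SFG(`E`)** (lead c9 sub-goal W1): if every value-`0` formal combination of representations of
dimension `< E` is a relation, then the special-fibre class `Σ mᵢ [r₀ᵢ]` of a dominated net `Rᵢ → r₀ᵢ` with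
fibres of dimension `d i < E`, whose total class `Σ mᵢ [Rᵢ]` is a fibred relation, is a relation: its value
is `0` (`eval_specialFibre_eq_zero`) and it lies on level `E`. [cite: KontsevichZagier2001, §1.2 Conjecture 1] -/
theorem stub_specialFibreGraded_of_kernelLevel : ∀ (E : ℕ), (∀ (x : KZ.FormalRep), x ∈ AddSubgroup.closure {y : KZ.FormalRep | ∃ (n : ℕ) (r : KZ.IntegralRep n), n < E ∧ y = KZ.of r} → KZ.eval x = 0 → x ∈ KZ.relations) → ∀ (k : ℕ) (d : Fin k → ℕ) (m : Fin k → ℤ) (R : (i : Fin k) → KZ.IntegralRep (d i + 1)) (r₀ g : (i : Fin k) → KZ.IntegralRep (d i)), (∀ i, d i < E) → (∀ i, KZ.IsDominatedFamily (R i) (r₀ i) (g i)) → (∑ i, m i • KZ.of (R i)) ∈ KZ.fibredRelations → (∑ i, m i • KZ.of (r₀ i)) ∈ KZ.relations := by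
  intro E hK k d m R r₀ g hd hR hG
  refine hK _ ?_ (eval_specialFibre_eq_zero m hR hG)
  refine AddSubgroup.sum_mem _ fun i _ => AddSubgroup.zsmul_mem _ (AddSubgroup.subset_closure ?_) _
  exact ⟨d i, r₀ i, hd i, rfl⟩

end Summit.KontsevichZagierPeriods.ValuedFieldSpecialisation
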